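import Literature.Computability.Complexity.DirectProductSampler
import HarnessLib

/-!
# Windows of a uniform bit string: counting tools

Analysis instalment (M9a-2, generic part) of the decomposition of the named fact
`Literature.Computability.Learning.cikk_natural_implies_learning` (CIKK 2016, Thm. 5.1): for a
window `[o, o + len)` of a bit string `r : Fin C → Bool`, the string is equivalently the pair
(bits outside the window, bits inside) — `windowEquiv` — so that

* `card_filter_eq_sum_window`: `#{r | P r} = Σ_{rest} #{w | P (glue rest w)}`;
* `card_filter_and_window`: if `E` ignores the window and `F` reads only the window,
  `#{r | E r ∧ F r} · 2^{len} = #{r | E r} · #{w | F̂ w}`;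
* `card_filter_window_le`: if every fibre of `P` over the outside bits has at most `B`
  window-assignments, `#{r | P r} ≤ B · 2^{C - len}`.

## References

* W. Feller, *An Introduction to Probability Theory and its Applications*, Vol. I, 3rd ed.,
  Wiley 1968, §V.3–V.4 (independent trials, product spaces) [Feller1968].
-/

namespace Literature.Computability.Learning

open Finset

section Window

variable {C o len : ℕ} (h : o + len ≤ C)

/-- Reading the window `[o, o+len)`. [folklore] -/
def windowRead (r : Fin C → Bool) : Fin len → Bool := fun i => r ⟨o + i, by omega⟩

/-- Reading the bits outside the window (in order). [folklore] -/
def restRead (r : Fin C → Bool) : Fin (C - len) → Bool :=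
  fun j => if hj : (j : ℕ) < o then r ⟨j, by omega⟩ else r ⟨j + len, by omega⟩

/-- Gluing outside bits and window bits. [folklore] -/
def glue (p : (Fin (C - len) → Bool) × (Fin len → Bool)) : Fin C → Bool :=
  fun i => if h1 : (i : ℕ) < o then p.1 ⟨i, by omega⟩
    else if h2 : (i : ℕ) < o + len then p.2 ⟨i - o, by omega⟩ else p.1 ⟨i - len, by omega⟩

/-- **The window equivalence** `(Fin C → Bool) ≃ (outside bits) × (window bits)`. [folklore] -/
def windowEquiv : (Fin C → Bool) ≃ (Fin (C - len) → Bool) × (Fin len → Bool) where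
  toFun r := (restRead h r, windowRead h r)
  invFun := glue h
  left_inv r := by
    funext i
    rcases lt_or_ge (i : ℕ) o with h1 | h1
    · simp [glue, restRead, h1]
    · rcases lt_or_ge (i : ℕ) (o + len) with h2 | h2
      · simp only [glue, windowRead, dif_neg (not_lt.2 h1), dif_pos h2]
        congr 1; exact Fin.ext (Nat.add_sub_cancel' h1)
      · simp only [glue, restRead, dif_neg (not_lt.2 h1), dif_neg (not_lt.2 h2)]
        rw [dif_neg (by omega)]
        congr 1; exact Fin.ext (Nat.sub_add_cancel (by omega : len ≤ (i : ℕ)))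
  right_inv p := by
    rcases p with ⟨rest, w⟩
    simp only [Prod.mk.injEq]
    constructor
    · funext j
      rcases lt_or_ge (j : ℕ) o with hj | hj
      · simp [restRead, glue, hj]
      · simp only [restRead, dif_neg (not_lt.2 hj), glue]
        rw [dif_neg (by omega), dif_neg (by omega)]
        congr 1; exact Fin.ext (Nat.add_sub_cancel (j : ℕ) len)
    · funext i
      simp only [windowRead, glue]
      rw [dif_neg (by omega), dif_pos (by omega)]
      congr 1; exact Fin.ext (Nat.add_sub_cancel_left o (i : ℕ))

/-- The window of a glued string. [folklore] -/
@[simp] theorem windowRead_glue (rest : Fin (C - len) → Bool) (w : Fin len → Bool) :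
    windowRead h (glue h (rest, w)) = w :=
  congrArg Prod.snd ((windowEquiv h).right_inv (rest, w))

/-- The outside of a glued string. [folklore] -/
@[simp] theorem restRead_glue (rest : Fin (C - len) → Bool) (w : Fin len → Bool) :
    restRead h (glue h (rest, w)) = rest :=
  congrArg Prod.fst ((windowEquiv h).right_inv (rest, w))

/-- **Counting through the window**: `#{r | P r} = Σ_{rest} #{w | P (glue rest w)}`. [cite: Feller1968, §V.4] -/
theorem card_filter_eq_sum_window (P : (Fin C → Bool) → Prop) [DecidablePred P] :
    (univ.filter P).card = ∑ rest : Fin (C - len) → Bool, (univ.filter fun w : Fin len → Bool => P (glue h (rest, w))).card := by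
  classical
  rw [← Finset.card_map (windowEquiv h).toEmbedding]
  have : (univ.filter P).map (windowEquiv h).toEmbedding =
      (univ ×ˢ univ).filter fun p : (Fin (C - len) → Bool) × (Fin len → Bool) => P (glue h p) := by
    ext p
    simp only [mem_map_equiv, mem_filter, mem_univ, true_and, mem_product]
    constructor
    · intro hp; rwa [show (windowEquiv h).symm p = glue h p from rfl] at hp
    · intro hp; exact hp
  rw [this, Finset.card_eq_sum_ones, Finset.sum_filter, Finset.sum_product]
  refine Finset.sum_congr rfl fun rest _ => ?_
  rw [Finset.card_eq_sum_ones, Finset.sum_filter]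

/-- **Independent windows multiply**: if `E` does not depend on the window and `F` depends only on
it, `#{E ∧ F} · 2^{len} = #{E} · #{F̂}`. [cite: Feller1968, §V.3 (multiplication rule for independent trials)] -/
theorem card_filter_and_window (E : (Fin C → Bool) → Prop) [DecidablePred E] (F : (Fin len → Bool) → Prop) [DecidablePred F]
    (hE : ∀ rest w w', E (glue h (rest, w)) ↔ E (glue h (rest, w'))) :
    (univ.filter fun r => E r ∧ F (windowRead h r)).card * 2 ^ len =
      (univ.filter E).card * (univ.filter F).card := by
  classical
  rw [card_filter_eq_sum_window h, card_filter_eq_sum_window h E, Finset.sum_mul, Finset.sum_mul]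
  refine Finset.sum_congr rfl fun rest _ => ?_
  let w₀ : Fin len → Bool := fun _ => false
  by_cases hr : E (glue h (rest, w₀))
  · have hall : ∀ w, E (glue h (rest, w)) := fun w => (hE rest w w₀).2 hr
    rw [Finset.filter_congr (q := fun w => F w) (fun w _ => by simp [hall w, windowRead_glue]),
      Finset.filter_true_of_mem (s := univ) (fun w _ => hall w), Finset.card_univ, Fintype.card_fun, Fintype.card_fin,
      Fintype.card_bool, mul_comm]
  · have hnone : ∀ w, ¬ E (glue h (rest, w)) := fun w hw => hr ((hE rest w w₀).1 hw)
    rw [Finset.filter_false_of_mem (s := univ) (fun w _ => by simp [hnone w]),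
      Finset.filter_false_of_mem (s := univ) (fun w _ => hnone w), Finset.card_empty, zero_mul, zero_mul]

/-- **Fibre bound**: if every fibre over the outside bits has at most `B` window assignments,
`#{r | P r} ≤ B · 2^{C-len}`. [cite: Feller1968, §V.4] -/
theorem card_filter_window_le (P : (Fin C → Bool) → Prop) [DecidablePred P] {B : ℝ}
    (hB : ∀ rest : Fin (C - len) → Bool, ((univ.filter fun w : Fin len → Bool => P (glue h (rest, w))).card : ℝ) ≤ B) :
    ((univ.filter P).card : ℝ) ≤ B * 2 ^ (C - len) := by
  rw [card_filter_eq_sum_window h, Nat.cast_sum]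
  calc ∑ rest : Fin (C - len) → Bool, ((univ.filter fun w : Fin len → Bool => P (glue h (rest, w))).card : ℝ)
      ≤ ∑ _rest : Fin (C - len) → Bool, B := Finset.sum_le_sum fun rest _ => hB rest
    _ = B * 2 ^ (C - len) := by
        rw [Finset.sum_const, Finset.card_univ, Fintype.card_fun, Fintype.card_fin, Fintype.card_bool, nsmul_eq_mul]
        push_cast; ring

end Window

end Literature.Computability.Learning
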